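import Mathlib
import HarnessLib
import Summits.AtomisticToContinuum.Crystallization.Theorems.HolmgrenBoyleLindHalfSpaceUniqueContinuationLayerSlices

/-!
# Route `HolmgrenBoyleLind`: Lennard-Jones force fields of separated sources, part 21b —
a Delone set with finitely many registry classes has a column of positive upper density

Support file for the crux item stmt-AtomisticToContinuum-6075 (`HalfSpaceUniqueContinuation`, line
`registered`, layered core, THICK COLUMNS FROM FINITELY MANY REGISTRIES; infrastructure written by a
stub-worker of lead c3). SETTING: a unit normal `u`, the plane `W = (ℝ ∙ u)ᗮ` with projection `P`,
a rank-2 lattice `Λ ⊂ W`, and a `Λ`-invariant, `δ`-separated, `r`-dense set `ω ⊂ ℝ³` whose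
registries `P x`, `x ∈ ω`, fall into FINITELY MANY classes modulo `Λ` (a finite set `S ⊂ W` with
`P x ∈ b + Λ` for some `b ∈ S`).

* **`hbl_exists_dense_column'`** (+ registered `∀`-form `hbl_exists_dense_column`) — below any
  level `a` there is a registry `b₀ ∈ S` whose normal column `b₀ + (a − 1 − t) u`, `t ≥ 1`, carries
  a sequence of points of `ω` with `δ`-separated depths of positive upper density (hence, by part
  21a, non-Blaschke). Proof: the slabs `a − 1 − (j+1)h < ⟪z,u⟫ ≤ a − 1 − jh`, `h = 2r + 1`, each
  contain a point of `ω` (`r`-density); by pigeonhole one class `b₀` occurs among the first `n`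
  slabs at least `n/|S|` times for infinitely many `n`; translating those points by `Λ` puts them ON
  the column through `b₀` (still in `ω`, same height), where distinct points are `δ`-apart in depth.
All `[folklore]`; nothing here closes an item.
-/

noncomputable section

namespace Summit.AtomisticToContinuum.Crystallization.Theorems.HolmgrenBoyleLind

open scoped BigOperators Topology InnerProductSpace RealInnerProductSpace
open Filter Set

/-- **A Delone set with finitely many registry classes has a column of positive upper density.**
See the module docstring. [folklore] -/
theorem hbl_exists_dense_column' {u : EuclideanSpace ℝ (Fin 3)} (hu : ‖u‖ = 1)
    (Λ : Submodule ℤ (ℝ ∙ u)ᗮ) [DiscreteTopology Λ] [IsZLattice ℝ Λ]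
    {ω : Set (EuclideanSpace ℝ (Fin 3))} {δ r : ℝ} (_hδ : 0 < δ) (hr : 0 < r)
    (hsep : ∀ x ∈ ω, ∀ y ∈ ω, x ≠ y → δ ≤ dist x y)
    (hdense : ∀ c : EuclideanSpace ℝ (Fin 3), ∃ y ∈ ω, dist y c ≤ r)
    (hinv : ∀ ℓ : Λ, ∀ y : EuclideanSpace ℝ (Fin 3),
      y + ((ℓ : (ℝ ∙ u)ᗮ) : EuclideanSpace ℝ (Fin 3)) ∈ ω ↔ y ∈ ω)
    (S : Finset (ℝ ∙ u)ᗮ)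
    (hS : ∀ x ∈ ω, ∃ b ∈ S, ∃ ℓ : Λ, (ℝ ∙ u)ᗮ.orthogonalProjectionOnto x = b + (ℓ : (ℝ ∙ u)ᗮ))
    (a : ℝ) :
    ∃ b₀ ∈ S, ∃ (t : ℕ → ℝ) (d : ℝ), 0 < d ∧ (∀ n, 1 ≤ t n) ∧ (∀ m n, m ≠ n → δ ≤ |t m - t n|) ∧
      (∀ T₀ : ℝ, ∃ T : ℝ, T₀ ≤ T ∧ d * T ≤ ({n : ℕ | t n ≤ T}.ncard : ℝ)) ∧
      ∀ n, ((b₀ : EuclideanSpace ℝ (Fin 3)) + (a - 1) • u) - t n • u ∈ ω := by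
  classical
  -- the slab height `h = 2r + 1`
  set h : ℝ := 2 * r + 1 with hh_def
  have hh : 0 < h := by positivity
  have hu0 : u ≠ 0 := by
    rintro rfl
    simp at hu
  have hmul : ∀ k : ℕ, (k : ℝ) ≤ k * h := fun k => by
    have e : (k : ℝ) * h = 2 * (k * r) + k := by rw [hh_def]; ring
    have : (0 : ℝ) ≤ k * r := by positivity
    linarith
  /- STEP 1: a point of `ω` in each slab `|⟪y, u⟫ - (a - 2 - r - j h)| ≤ r`. -/
  have step1 : ∀ j : ℕ, ∃ y ∈ ω, |⟪y, u⟫ - (a - 2 - r - j * h)| ≤ r := by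
    intro j
    obtain ⟨y, hy, hd⟩ := hdense ((a - 2 - r - j * h) • u)
    refine ⟨y, hy, ?_⟩
    have key : ⟪y, u⟫ - (a - 2 - r - j * h) = ⟪y - (a - 2 - r - j * h) • u, u⟫ := by
      rw [inner_sub_left, real_inner_smul_left, real_inner_self_eq_norm_sq, hu]
      ring
    rw [key]
    calc |⟪y - (a - 2 - r - j * h) • u, u⟫|
        ≤ ‖y - (a - 2 - r - j * h) • u‖ * ‖u‖ := abs_real_inner_le_norm _ _
      _ = dist y ((a - 2 - r - j * h) • u) := by rw [hu, mul_one, dist_eq_norm]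
      _ ≤ r := hd
  choose y hyω hyu using step1
  /- STEP 2: registries `b j ∈ S`, lattice corrections `ℓ j`, depths `s j`, and translation of
  `y j` onto the column through `b j`. -/
  choose b hbS ℓ hbℓ using fun j => hS (y j) (hyω j)
  set s : ℕ → ℝ := fun j => a - 1 - ⟪y j, u⟫ with hs_def
  have hs_lb : ∀ j : ℕ, 1 + j * h ≤ s j := by
    intro j
    have := (abs_le.1 (hyu j)).2
    show 1 + (j : ℝ) * h ≤ a - 1 - ⟪y j, u⟫
    linarith
  have hs_ub : ∀ j : ℕ, s j ≤ 1 + 2 * r + j * h := by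
    intro j
    have := (abs_le.1 (hyu j)).1
    show a - 1 - ⟪y j, u⟫ ≤ 1 + 2 * r + j * h
    linarith
  have hs_mono : StrictMono s := by
    refine strictMono_nat_of_lt_succ fun j => ?_
    calc s j ≤ 1 + 2 * r + j * h := hs_ub j
      _ < 1 + ((j + 1 : ℕ) : ℝ) * h := by
          have e : ((j + 1 : ℕ) : ℝ) * h = j * h + h := by push_cast; ring
          rw [e]
          linarith
      _ ≤ s (j + 1) := hs_lb (j + 1)
  have hxω : ∀ j : ℕ,
      ((b j : EuclideanSpace ℝ (Fin 3)) + (a - 1) • u) - s j • u ∈ ω := by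
    intro j
    have hsj : ⟪y j, u⟫ = a - 1 - s j := by simp only [hs_def]; ring
    have key : ((b j : EuclideanSpace ℝ (Fin 3)) + (a - 1) • u) - s j • u +
        (((ℓ j : Λ) : (ℝ ∙ u)ᗮ) : EuclideanSpace ℝ (Fin 3)) = y j := by
      conv_rhs => rw [hbl_eq_proj_add_inner_smul hu (y j), hbℓ j]
      rw [Submodule.coe_add, hsj]
      module
    have hmem := hyω j
    rw [← key, hinv (ℓ j)] at hmem
    exact hmem
  /- STEP 3: pigeonhole with density — a class `b₀` used at least `m / |S|` times among the first
  `m` slabs, for infinitely many `m`. -/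
  have hSne : S.Nonempty := ⟨b 0, hbS 0⟩
  have hScard : (0 : ℝ) < S.card := by exact_mod_cast hSne.card_pos
  have step3 : ∀ m : ℕ, ∃ b' ∈ S,
      (m : ℝ) / S.card ≤ (((Finset.range m).filter (fun j => b j = b')).card : ℝ) := by
    intro m
    refine Finset.exists_le_card_fiber_of_nsmul_le_card_of_maps_to (fun j _ => hbS j) hSne ?_
    rw [Finset.card_range, nsmul_eq_mul, mul_div_cancel₀ _ hScard.ne']
  choose g hgS hg using step3
  obtain ⟨b₀, hb₀S, hinf⟩ : ∃ b₀ ∈ S, {m : ℕ | g m = b₀}.Infinite := by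
    obtain ⟨⟨b₀, hb₀⟩, hb⟩ := Finite.exists_infinite_fiber fun m : ℕ => (⟨g m, hgS m⟩ : S)
    refine ⟨b₀, hb₀, (Set.infinite_coe_iff.mp hb).mono fun m hm => ?_⟩
    exact Subtype.ext_iff.mp (Set.mem_singleton_iff.mp (Set.mem_preimage.mp hm))
  -- the class `b₀` occurs infinitely often
  have hJ : (setOf fun j : ℕ => b j = b₀).Infinite := by
    intro hfin
    obtain ⟨m, hm, hlt⟩ := hinf.exists_gt (S.card * hfin.toFinset.card)
    have h1 := hg m
    rw [show g m = b₀ from hm, div_le_iff₀ hScard] at h1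
    have h2 : ((Finset.range m).filter (fun j => b j = b₀)).card ≤ hfin.toFinset.card :=
      Finset.card_le_card fun j hj => by
        simp only [Finset.mem_filter] at hj
        simpa using hj.2
    have h2' : (((Finset.range m).filter (fun j => b j = b₀)).card : ℝ) ≤ hfin.toFinset.card := by
      exact_mod_cast h2
    have h3 := mul_le_mul_of_nonneg_right h2' hScard.le
    have h4 : ((S.card * hfin.toFinset.card : ℕ) : ℝ) < m := by exact_mod_cast hlt
    push_cast at h4
    linarith
  -- enumerate the class `b₀` increasingly: `φ = Nat.nth`
  set φ : ℕ → ℕ := Nat.nth fun j => b j = b₀ with hφ_def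
  have hφ : StrictMono φ := Nat.nth_strictMono hJ
  have hφmem : ∀ n, b (φ n) = b₀ := Nat.nth_mem_of_infinite hJ
  -- the depths of the column through `b₀`
  set t : ℕ → ℝ := fun n => s (φ n) with ht_def
  have ht_mono : StrictMono t := hs_mono.comp hφ
  have ht_lb : ∀ n : ℕ, 1 + n * h ≤ t n := fun n => by
    have h1 : (n : ℝ) ≤ (φ n : ℕ) := Nat.cast_le.mpr (hφ.le_apply (x := n))
    have h2 := mul_le_mul_of_nonneg_right h1 hh.le
    have h3 := hs_lb (φ n)
    show 1 + (n : ℝ) * h ≤ s (φ n)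
    linarith
  have ht_one : ∀ n, 1 ≤ t n := fun n =>
    le_trans (le_add_of_nonneg_right (by positivity)) (ht_lb n)
  have htω : ∀ n, ((b₀ : EuclideanSpace ℝ (Fin 3)) + (a - 1) • u) - t n • u ∈ ω := by
    intro n
    have := hxω (φ n)
    rwa [hφmem n] at this
  refine ⟨b₀, hb₀S, t, 1 / (2 * h * S.card), by positivity, ht_one, ?_, ?_, htω⟩
  · -- separation of the depths: distinct points of `ω` on one normal line are `δ` apart
    intro m n hmn
    have hne : t m ≠ t n := fun heq => hmn (ht_mono.injective heq)
    have hdiff : ((b₀ : EuclideanSpace ℝ (Fin 3)) + (a - 1) • u) - t m • u -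
        (((b₀ : EuclideanSpace ℝ (Fin 3)) + (a - 1) • u) - t n • u) = (t n - t m) • u := by
      module
    have hpts : ((b₀ : EuclideanSpace ℝ (Fin 3)) + (a - 1) • u) - t m • u ≠
        ((b₀ : EuclideanSpace ℝ (Fin 3)) + (a - 1) • u) - t n • u := by
      intro heq
      have h0 : (t n - t m) • u = 0 := by rw [← hdiff, heq, sub_self]
      rcases smul_eq_zero.1 h0 with h0 | h0
      · exact hne (sub_eq_zero.1 h0).symm
      · exact hu0 h0
    have hdist : dist (((b₀ : EuclideanSpace ℝ (Fin 3)) + (a - 1) • u) - t m • u)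
        (((b₀ : EuclideanSpace ℝ (Fin 3)) + (a - 1) • u) - t n • u) = |t m - t n| := by
      rw [dist_eq_norm, hdiff, norm_smul, hu, mul_one, Real.norm_eq_abs, abs_sub_comm]
    exact hdist ▸ hsep _ (htω m) _ (htω n) hpts
  · -- positive upper density of the depths
    intro T₀
    obtain ⟨m, hm, hmgt⟩ := hinf.exists_gt ⌈T₀⌉₊
    have hm1 : (1 : ℝ) ≤ m := by exact_mod_cast Nat.one_le_iff_ne_zero.2 (by omega)
    have hmT₀ : T₀ ≤ m := (Nat.le_ceil T₀).trans (by exact_mod_cast hmgt.le)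
    refine ⟨1 + 2 * r + m * h, by linarith [hmul m], ?_⟩
    have hcount : (m : ℝ) / S.card ≤ (Nat.count (fun j => b j = b₀) m : ℝ) := by
      have := hg m
      rw [show g m = b₀ from hm] at this
      rw [Nat.count_eq_card_filter_range]
      exact this
    have hsub : (↑(Finset.range (Nat.count (fun j => b j = b₀) m)) : Set ℕ) ⊆
        {n : ℕ | t n ≤ 1 + 2 * r + m * h} := by
      intro n hn
      rw [Finset.coe_range, Set.mem_Iio] at hn
      have hlt := Nat.nth_lt_of_lt_count hn
      show s (φ n) ≤ 1 + 2 * r + m * h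
      calc s (φ n) ≤ 1 + 2 * r + ((φ n : ℕ) : ℝ) * h := hs_ub _
        _ ≤ 1 + 2 * r + m * h := by
            have h1 : ((φ n : ℕ) : ℝ) ≤ m := by exact_mod_cast hlt.le
            have h2 := mul_le_mul_of_nonneg_right h1 hh.le
            linarith
    have hfin : {n : ℕ | t n ≤ 1 + 2 * r + m * h}.Finite := by
      refine (Set.finite_Iic ⌊1 + 2 * r + m * h⌋₊).subset fun n hn => ?_
      simp only [Set.mem_setOf_eq] at hn
      rw [Set.mem_Iic]
      refine Nat.le_floor ?_
      linarith [ht_lb n, hmul n]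
    have hle := Set.ncard_le_ncard hsub hfin
    rw [Set.ncard_coe_finset, Finset.card_range] at hle
    calc 1 / (2 * h * S.card) * (1 + 2 * r + m * h) = (m + 1) / (2 * S.card) := by
          rw [hh_def]
          field_simp
          ring
      _ ≤ m / S.card := by
          rw [div_le_div_iff₀ (by positivity) hScard]
          nlinarith
      _ ≤ Nat.count (fun j => b j = b₀) m := hcount
      _ ≤ _ := by exact_mod_cast hle

/-- **A Delone set with finitely many registry classes has a column of positive upper density**
(registered `∀`-form of `hbl_exists_dense_column'`). [folklore] -/
theorem hbl_exists_dense_column : ∀ {u : EuclideanSpace ℝ (Fin 3)} (hu : ‖u‖ = 1) (Λ : Submodule ℤ (ℝ ∙ u)ᗮ) [DiscreteTopology Λ] [IsZLattice ℝ Λ] {ω : Set (EuclideanSpace ℝ (Fin 3))} {δ r : ℝ}, 0 < δ → 0 < r → (∀ x ∈ ω, ∀ y ∈ ω, x ≠ y → δ ≤ dist x y) → (∀ c : EuclideanSpace ℝ (Fin 3), ∃ y ∈ ω, dist y c ≤ r) → (∀ ℓ : Λ, ∀ y : EuclideanSpace ℝ (Fin 3), y + ((ℓ : (ℝ ∙ u)ᗮ)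 : EuclideanSpace ℝ (Fin 3)) ∈ ω ↔ y ∈ ω) → ∀ (S : Finset (ℝ ∙ u)ᗮ), (∀ x ∈ ω, ∃ b ∈ S, ∃ ℓ : Λ, (ℝ ∙ u)ᗮ.orthogonalProjectionOnto x = b + (ℓ : (ℝ ∙ u)ᗮ)) → ∀ (a : ℝ), ∃ b₀ ∈ S, ∃ (t : ℕ → ℝ) (d : ℝ), 0 < d ∧ (∀ n : ℕ, 1 ≤ t n) ∧ (∀ m n : ℕ, m ≠ n → δ ≤ |t m - t n|) ∧ (∀ T₀ : ℝ, ∃ T : ℝ, T₀ ≤ T ∧ d * T ≤ (({n : ℕ | t n ≤ T} : Set ℕ).ncard : ℝ)) ∧ ∀ n : ℕ, ((b₀ : EuclideanSpace ℝ (Fin 3)) + (a - 1) • u) - t n • u ∈ ω := by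
  intro u hu Λ _ _ ω δ r hδ hr hsep hdense hinv S hS a
  exact hbl_exists_dense_column' hu Λ hδ hr hsep hdense hinv S hS a

end Summit.AtomisticToContinuum.Crystallization.Theorems.HolmgrenBoyleLind

end
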